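import Summits.CriticalPhenomena.PercolationContinuityZ3.Theorems.PercNearOneGluingNoHeavyPcintMemCountBinomial
import Summits.CriticalPhenomena.PercolationContinuityZ3.Theorems.PercNearOneGluingNoHeavyPcintMemUniformGenBounds
import HarnessLib

/-!
# CriticalPhenomena/PercolationContinuityZ3 — Theorems/PercNearOneGluingNoHeavyPcintMemUniformExtrapolate.lean: the transfer theorem one dimension LOWER — a dimension-`(k+1)` row list also certifies `μ_τ(ℤ^k)`, by POLYNOMIAL EXTRAPOLATION

Lane prim-pcint, STRUCTURE rule (prim-pcint-2 GEN 19).  …MemUniformGen shows that a structurally valid dimension-`(k+1)` row list supported off axis `k`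
simulates `mstep τ` on `ℤ^d` for every `d ≥ k + 1`; the memory-`τ` class automata are already complete in dimension `τ/2 = k` (STRUCTURE N9/P20: e.g. the
6192 memory-10 classes of `ℤ⁵`), but the padding argument cannot go DOWN.  Here it is done by polynomial extrapolation:
* the index-automaton count `cnt (uistepK k L d) i n` is, for every `d ≥ k` (including `d = k`, where it reads only the letters of the first `k` axes:
  `sum_uistepK_low`), the value at `d` of ONE real polynomial `uPolyF L n i` (first-letter recursion with the factor `X − (k+1)` on the fresh pair);
* `memCount d τ n` is the value at `d` of the binomial polynomial `memPoly τ n` (…MemCountBinomial);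
* both agree for all `d ≥ k + 1` (…MemUniformGen), hence as polynomials (`Polynomial.eq_of_infinite_eval_eq`), hence at `d = k`:
  **`memCount_eq_cnt_uistepK_low`**: `memCount k τ n = cnt (uistepK k L k) 0 n`;
* consequently the real-weight Collatz–Wielandt bounds hold at `d = k` with row sums `base_i(w) − fresh_i(w)`:
  **`memGrowth_le_of_ucertK_low`**, **`le_memGrowth_of_ucertK_low`**.

HONEST FRAMING: bookkeeping (polynomial identity principle); no `sorry`; standard axioms.  Written by prim-pcint-2 gen 19, 2026-08-26.
-/

noncomputable section

open Polynomial
open Literature.Probability.Percolation Literature.Probability.LatticeModels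

namespace Summit.CriticalPhenomena.PercolationContinuityZ3.Theorems.Pcint

variable {k d : ℕ}

/-! ### The count polynomial of the uniform index automaton -/

/-- Value of a family at an optional index (`0` at `none`). [folklore] -/
def optP (o : Option ℕ) (f : ℕ → ℝ[X]) : ℝ[X] :=
  match o with
  | none => 0
  | some j => f j

/-- The count polynomial: `uPolyF L 0 i = 1`, `uPolyF L (n+1) i = Σ_a optP (sistep L i a) + (X − (k+1))·Σ_b optP (sistep L i (last, b))`. [folklore] -/
def uPolyF (L : List (SCertRow (k + 1))) : ℕ → ℕ → ℝ[X]
  | 0 => fun _ => 1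
  | n + 1 => fun i =>
    (∑ a : Fin (k + 1) × Bool, optP (sistep L i a) (uPolyF L n)) +
      (X - C ((k : ℝ) + 1)) * ∑ b : Bool, optP (sistep L i (Fin.last k, b)) (uPolyF L n)

/-- Evaluation of `optP` is `optValR` of the evaluations. [folklore] -/
theorem eval_optP (o : Option ℕ) (f : ℕ → ℝ[X]) (x : ℝ) : (optP o f).eval x = optValR (fun j => (f j).eval x) o := by
  cases o <;> simp [optP]

/-- At `d = k` the uniform index automaton reads only the letters of the first `k` axes: its letter sum is `base − fresh`. [folklore] -/
theorem sum_uistepK_low (L : List (SCertRow (k + 1))) (w : ℕ → ℝ) (i : ℕ) :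
    ∑ a : Fin k × Bool, optValR w (uistepK k L k i a) = baseSumK L w i - freshSumK L w i := by
  have h1 : ∀ a : Fin k × Bool, uistepK k L k i a = sistep L i (Fin.castSucc a.1, a.2) := by
    rintro ⟨v, b⟩
    unfold uistepK
    rw [dif_pos (Nat.lt_succ_of_lt v.isLt)]
    rfl
  simp only [h1, baseSumK, freshSumK, Fintype.sum_prod_type]
  rw [Fin.sum_univ_castSucc]
  ring

/-- **The count of the uniform index automaton is the count polynomial, for every `d ≥ k`** (at `d = k` with the fresh pair removed). [folklore] -/
theorem cnt_uistepK_eq_eval (L : List (SCertRow (k + 1))) (hd : k ≤ d) (n i : ℕ) :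
    (cnt (uistepK k L d) i n : ℝ) = (uPolyF L n i).eval (d : ℝ) := by
  induction n generalizing i with
  | zero => simp [cnt, uPolyF]
  | succ n ih =>
    rw [cnt_succ_real]
    simp only [uPolyF, eval_add, eval_mul, eval_sub, eval_X, eval_C, eval_finsetSum, eval_optP]
    have hfun : (fun j => (uPolyF L n j).eval (d : ℝ)) = fun j => (cnt (uistepK k L d) j n : ℝ) := by
      funext j; rw [ih]
    rw [hfun]
    rcases Nat.lt_or_ge k d with hlt | hge
    · rw [sum_uistepK L (by omega) _ i]; rfl
    · have hdk : d = k := le_antisymm hge hd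
      subst hdk
      rw [sum_uistepK_low]
      simp only [baseSumK, freshSumK]
      ring

/-! ### The binomial count polynomial -/

/-- `memPoly τ n = Σ_{j ≤ n} E_{τ,n,j}·binom(X, j)` with `binom(X, j) = X(X−1)⋯(X−j+1)/j!`. [folklore] -/
def memPoly (τ n : ℕ) : ℝ[X] :=
  ∑ j ∈ Finset.range (n + 1), ((MemoryTail.fullMemCount j τ n : ℝ) / (j.factorial : ℝ)) • descPochhammer ℝ j

/-- **`memPoly` evaluates to the memory counts at every natural number.** [folklore] -/
theorem eval_memPoly (τ n d : ℕ) : (memPoly τ n).eval (d : ℝ) = (MemoryTail.memCount d τ n : ℝ) := by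
  rw [MemoryTail.memCount_eq_sum_choose_real, memPoly, eval_finsetSum]
  refine Finset.sum_congr rfl fun j _ => ?_
  rw [eval_smul, descPochhammer_eval_eq_descFactorial, Nat.descFactorial_eq_factorial_mul_choose, smul_eq_mul]
  have hj : (j.factorial : ℝ) ≠ 0 := by exact_mod_cast j.factorial_ne_zero
  push_cast
  field_simp

/-- **Polynomial extrapolation**: for a structurally valid dimension-`(k+1)` list supported off axis `k`, the memory counts of `ℤ^k` are the counts of
the uniform index automaton read in dimension `k`. [folklore] -/
theorem memCount_eq_cnt_uistepK_low {τ : ℕ} {L : List (SCertRow (k + 1))} (hτ : 2 ≤ τ) (hU : UStructK τ L) (hS : USuppK L) (n : ℕ) :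
    MemoryTail.memCount k τ n = cnt (uistepK k L k) 0 n := by
  -- the two polynomials agree at every `d ≥ k + 1`
  have hagree : ∀ d : ℕ, k + 1 ≤ d → (memPoly τ n).eval (d : ℝ) = (uPolyF L n 0).eval (d : ℝ) := by
    intro d hd
    haveI : NeZero d := ⟨by omega⟩
    rw [eval_memPoly, ← cnt_uistepK_eq_eval L (by omega), ← cnt_mstep_eq_cnt_uistepK hd hU hS n, cnt_mstep_empty_eq_memCount hτ]
  have hinf : {x : ℝ | (memPoly τ n).eval x = (uPolyF L n 0).eval x}.Infinite := by
    have hr : (Set.range fun m : ℕ => ((m + (k + 1) : ℕ) : ℝ)).Infinite :=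
      Set.infinite_range_of_injective fun a b h => by
        have : (a + (k + 1) : ℕ) = b + (k + 1) := by exact_mod_cast h
        omega
    refine hr.mono ?_
    rintro x ⟨m, rfl⟩
    exact hagree (m + (k + 1)) (by omega)
  have heq := Polynomial.eq_of_infinite_eval_eq _ _ hinf
  have h : (memPoly τ n).eval (k : ℝ) = (uPolyF L n 0).eval (k : ℝ) := by rw [heq]
  rw [eval_memPoly, ← cnt_uistepK_eq_eval L le_rfl] at h
  exact_mod_cast h

/-! ### Collatz–Wielandt at `d = k` -/

/-- Successor indices of the uniform index automaton stay inside the list (any reading dimension). [folklore] -/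
theorem uistepK_lt_length {τ : ℕ} {L : List (SCertRow (k + 1))} (hU : UStructK τ L) {i : ℕ} (hi : i < L.length)
    {a : Fin d × Bool} {j : ℕ} (h : uistepK k L d i a = some j) : j < L.length := by
  have key : ∀ a' : Fin (k + 1) × Bool, sistep L i a' = some j → j < L.length := by
    intro a' ha'
    unfold sistep at ha'
    cases hss : ssucc L i a' with
    | none => rw [hss] at ha'; simp at ha'
    | some p =>
      rw [hss] at ha'
      simp only [Option.map_some, Option.some.injEq] at ha'
      have := (hU.2.2 i hi a').2 p (by rw [hss]; rfl)
      rwa [ha'] at this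
  unfold uistepK at h
  split_ifs at h with hlt
  · exact key _ h
  · exact key _ h

/-- **Uniform UPPER certificate at `d = k`**: `μ_τ(ℤ^k) ≤ λ` from positive real weights with `base_i(w) − fresh_i(w) ≤ λ·w_i`. [cite: PonitzTittmann2000, §3] -/
theorem memGrowth_le_of_ucertK_low [NeZero k] {τ : ℕ} {L : List (SCertRow (k + 1))} (hτ : 2 ≤ τ)
    (hU : UStructK τ L) (hS : USuppK L) (w : ℕ → ℝ) (lam : ℝ) (hlam : 0 < lam)
    (hw : ∀ i < L.length, 0 < w i)
    (hrow : ∀ i < L.length, baseSumK L w i - freshSumK L w i ≤ lam * w i) :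
    MemoryTail.memGrowth k τ ≤ lam := by
  have h0 : 0 < L.length := hU.1
  set R : Set ℕ := {i | i < L.length}
  have hR : ∀ i ∈ R, ∀ a j, uistepK k L k i a = some j → j ∈ R := fun i hi a j hij => uistepK_lt_length hU hi hij
  obtain ⟨i₀, hi₀, hmin⟩ := (Finset.range L.length).exists_min_image w ⟨0, by simpa using h0⟩
  set m := w i₀
  have hm : 0 < m := hw i₀ (by simpa using hi₀)
  have hmle : ∀ i ∈ R, m ≤ w i := fun i hi => hmin i (Finset.mem_range.2 hi)
  have hrow' : ∀ i ∈ R, ∑ a : Fin k × Bool, optValR w (uistepK k L k i a) ≤ lam * w i := by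
    intro i hi; rw [sum_uistepK_low L w i]; exact hrow i hi
  have hcw := cnt_le_of_realCert (uistepK k L k) R hR w lam m hlam.le hmle hrow'
  refine memGrowth_le_of_geometric (C := w 0 / m) (by have := hw 0 h0; positivity) hlam fun n _ => ?_
  have h1 := hcw n 0 h0
  rw [← memCount_eq_cnt_uistepK_low hτ hU hS n] at h1
  rw [div_mul_eq_mul_div, le_div_iff₀ hm]
  linarith

/-- **Uniform LOWER certificate at `d = k`**: `λ ≤ μ_τ(ℤ^k)` from positive real weights with `λ·w_i ≤ base_i(w) − fresh_i(w)`. [cite: PonitzTittmann2000, §3] -/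
theorem le_memGrowth_of_ucertK_low [NeZero k] {τ : ℕ} {L : List (SCertRow (k + 1))} (hτ : 2 ≤ τ)
    (hU : UStructK τ L) (hS : USuppK L) (w : ℕ → ℝ) (lam : ℝ) (hlam : 0 < lam)
    (hw : ∀ i < L.length, 0 < w i)
    (hrow : ∀ i < L.length, lam * w i ≤ baseSumK L w i - freshSumK L w i) :
    lam ≤ MemoryTail.memGrowth k τ := by
  have h0 : 0 < L.length := hU.1
  set R : Set ℕ := {i | i < L.length}
  have hR : ∀ i ∈ R, ∀ a j, uistepK k L k i a = some j → j ∈ R := fun i hi a j hij => uistepK_lt_length hU hi hij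
  obtain ⟨i₁, hi₁, hmax⟩ := (Finset.range L.length).exists_max_image w ⟨0, by simpa using h0⟩
  set M := w i₁
  have hM : 0 < M := hw i₁ (by simpa using hi₁)
  have hMle : ∀ i ∈ R, w i ≤ M := fun i hi => hmax i (Finset.mem_range.2 hi)
  have hrow' : ∀ i ∈ R, lam * w i ≤ ∑ a : Fin k × Bool, optValR w (uistepK k L k i a) := by
    intro i hi; rw [sum_uistepK_low L w i]; exact hrow i hi
  have hcw := cnt_ge_of_realSubcert (uistepK k L k) R hR w lam M hlam.le hMle hrow'
  have hw0 := hw 0 h0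
  refine le_memGrowth_of_geometric_le (K := M / w 0) (ρ := lam) (by positivity) hlam fun n _ => ?_
  have h1 := hcw n 0 h0
  rw [← memCount_eq_cnt_uistepK_low hτ hU hS n] at h1
  rw [div_le_iff₀ (by positivity)]
  calc lam ^ n ≤ M * (MemoryTail.memCount k τ n : ℝ) / w 0 := by rw [le_div_iff₀ hw0]; linarith
    _ = (MemoryTail.memCount k τ n : ℝ) * (M / w 0) := by ring

end Summit.CriticalPhenomena.PercolationContinuityZ3.Theorems.Pcint
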